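import Summits.CriticalPhenomena.PercolationContinuityZ3.Theorems.PercNearOneGluingNoHeavyLowerTailOneSumApexBlockGlue
import Summits.CriticalPhenomena.PercolationContinuityZ3.Theorems.PercNearOneGluingNoHeavyLowerTailApexTwoSum
import HarnessLib

/-!
# `NoHeavyLowerTail` (stmt-CriticalPhenomena-4575) — 1-SUMS, THE APEX BLOCK, MEASURE LEVEL (every `q > 0`):
# if the apex's block hangs at a cut vertex `u` and contains no terminal, R1 for `(u; b, c)` on the far piece gives R1 for `(a; b, c)`

Support file (prover prim-gen-kcluster gen 72; `--supports stmt-CriticalPhenomena-4575`).  No definitions, no named facts, no sorries.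
SETTING as in `…OneSumApexBlockGlue`: supports `DX ∋ a` (apex private, `a ≠ u`) and `DY ∋ b, c` (private, `≠ u`) meeting only in `u`;
`w` vanishing off `DX ∪ DY`, `wX = w·1_{DX}`, `wY = w·1_{DXᶜ}`.  Every R1 cell of the glued instance `(a; b, c)` factorises:
`Zφ(cell) · q^{k(∅)} = M_X(u ∈ C(a)) · R_Y(cell of (u; b, c))` (`pt_*`, `glued_*_sum`; the separating cell under `c ∈ cl DY b`), hence
`U_bU_c − TS = M_X(u ∈ C(a))² · (U_bU_c − TS)_Y` and

**THEOREM** (`OneSumApex.r1_of_apexBlock`): R1 for `(u; b, c)` on `rcMeasureW wY q ∅` (support `DY`) and `c ∈ cl DY b` imply R1 for `(a; b, c)` on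
`rcMeasureW w q ∅` (support `D = DX ∪ DY`).  (gen 57 §3.2: a minimal counterexample to R1-RC has no cut vertex separating the apex from both
terminals — kernel modulo landing.)
-/

noncomputable section

namespace Summit.CriticalPhenomena.PercolationContinuityZ3.Theorems

namespace OneSumApex

open Finset SimpleGraph Literature.Probability.Percolation Literature.Probability.Percolation.Gladkov
open Literature.Probability.Percolation.BHK2006 (weight)
open Literature.Probability.Percolation.DecisionTree (ind ind_of_mem ind_of_not_mem ind_nonneg)
open Literature.Probability.LatticeModels RefinedRowR3 ThreePointLB MeasureTheory
open scoped Classical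

variable {V : Type*} [Fintype V]

section Pointwise

variable {DX DY : Finset (Sym2 V)} {a b c u : V} (hau : a ≠ u) (hbu : b ≠ u) (hcu : c ≠ u) (hab : a ≠ b) (hac : a ≠ c) (hbc : b ≠ c)
  (hsepD : ∀ x : V, (∃ e ∈ DX, x ∈ e) → (∃ e ∈ DY, x ∈ e) → (x = u ∨ x = u))
  (haY : ∀ e ∈ DY, a ∉ e) (hbX : ∀ e ∈ DX, b ∉ e) (hcX : ∀ e ∈ DX, c ∉ e)
  (w : Sym2 V → unitInterval) (q : ℝ) (hw : ∀ e, e ∉ (↑DX ∪ ↑DY : Set (Sym2 V)) → (w e : ℝ) = 0)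
include hau hab hac hsepD haY hbX hcX hw

/-- **Pointwise, cell `T`**: `w_φ(ω)1_T(ω)q^{k(∅)} = weight(ω)·F_X(ζ_X)·F^Y_T(ζ_Y)`. [this work] -/
theorem pt_T (ω : BondConfig V) :
    rcWeightW w q ∅ ω * ind {η : BondConfig V | b ∈ cl η.toFinset a ∧ c ∈ cl η.toFinset a} ω * q ^ clusterCount (∅ : BondConfig V) ({u, u} : Set V) =
      weight (fun e => (w e : ℝ)) ω * ((ind {η : BondConfig V | u ∈ cl η.toFinset a} (ω ∩ ↑DX) * q ^ clusterCount (ω ∩ ↑DX) ({u, u} : Set V)) * (ind {η : BondConfig V | b ∈ cl η.toFinset u ∧ c ∈ cl η.toFinset u} (ω \ ↑DX) * q ^ clusterCount (ω \ ↑DX) ({u, u} : Set V))) := by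
  by_cases hω : ω ⊆ ↑DX ∪ ↑DY
  swap
  · obtain ⟨e, heω, heD⟩ := Set.not_subset.1 hω
    have h0 := ApexTwoSum.weight_eq_zero_of_mem_not_mem w hw heω heD
    unfold rcWeightW
    rw [h0]; ring
  have jb := glued_t_iff hau hsepD haY hab hbX hω
  have jc := glued_t_iff hau hsepD haY hac hcX hω
  have hadd := ApexTwoSum.kT_add hsepD hω
  have hk : clusterCount ω ∅ = clusterCount ω ({u, u} : Set V) := (clusterCount_pair_self u ω).symm
  have hpow : q ^ clusterCount ω ∅ * q ^ clusterCount (∅ : BondConfig V) ({u, u} : Set V) = q ^ clusterCount (ω ∩ ↑DX) ({u, u} : Set V) * q ^ clusterCount (ω \ ↑DX) ({u, u} : Set V) := by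
    rw [← pow_add, hk, hadd, pow_add]
  by_cases hm : (ω ∩ ↑DX) ∈ {η : BondConfig V | u ∈ cl η.toFinset a}
  · by_cases hy : (ω \ ↑DX) ∈ {η : BondConfig V | b ∈ cl η.toFinset u ∧ c ∈ cl η.toFinset u}
    · rw [ind_of_mem hm, ind_of_mem hy, ind_of_mem (show ω ∈ {η : BondConfig V | b ∈ cl η.toFinset a ∧ c ∈ cl η.toFinset a} from ⟨jb.2 ⟨hm, hy.1⟩, jc.2 ⟨hm, hy.2⟩⟩)]
      unfold rcWeightW
      linear_combination (weight (fun e => (w e : ℝ)) ω) * hpow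
    · rw [ind_of_mem hm, ind_of_not_mem hy, ind_of_not_mem (show ω ∉ {η : BondConfig V | b ∈ cl η.toFinset a ∧ c ∈ cl η.toFinset a} from fun hT => hy ⟨(jb.1 hT.1).2, (jc.1 hT.2).2⟩)]
      ring
  · rw [ind_of_not_mem hm, ind_of_not_mem (show ω ∉ {η : BondConfig V | b ∈ cl η.toFinset a ∧ c ∈ cl η.toFinset a} from fun hT => hm (jb.1 hT.1).1)]
    ring

/-- **Pointwise, cell `U_b`.** [this work] -/
theorem pt_Ub (ω : BondConfig V) :
    rcWeightW w q ∅ ω * ind {η : BondConfig V | b ∈ cl η.toFinset a ∧ c ∉ cl η.toFinset a} ω * q ^ clusterCount (∅ : BondConfig V) ({u, u} : Set V) =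
      weight (fun e => (w e : ℝ)) ω * ((ind {η : BondConfig V | u ∈ cl η.toFinset a} (ω ∩ ↑DX) * q ^ clusterCount (ω ∩ ↑DX) ({u, u} : Set V)) * (ind {η : BondConfig V | b ∈ cl η.toFinset u ∧ c ∉ cl η.toFinset u} (ω \ ↑DX) * q ^ clusterCount (ω \ ↑DX) ({u, u} : Set V))) := by
  by_cases hω : ω ⊆ ↑DX ∪ ↑DY
  swap
  · obtain ⟨e, heω, heD⟩ := Set.not_subset.1 hω
    have h0 := ApexTwoSum.weight_eq_zero_of_mem_not_mem w hw heω heD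
    unfold rcWeightW
    rw [h0]; ring
  have jb := glued_t_iff hau hsepD haY hab hbX hω
  have jc := glued_t_iff hau hsepD haY hac hcX hω
  have hadd := ApexTwoSum.kT_add hsepD hω
  have hk : clusterCount ω ∅ = clusterCount ω ({u, u} : Set V) := (clusterCount_pair_self u ω).symm
  have hpow : q ^ clusterCount ω ∅ * q ^ clusterCount (∅ : BondConfig V) ({u, u} : Set V) = q ^ clusterCount (ω ∩ ↑DX) ({u, u} : Set V) * q ^ clusterCount (ω \ ↑DX) ({u, u} : Set V) := by
    rw [← pow_add, hk, hadd, pow_add]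
  by_cases hm : (ω ∩ ↑DX) ∈ {η : BondConfig V | u ∈ cl η.toFinset a}
  · by_cases hy : (ω \ ↑DX) ∈ {η : BondConfig V | b ∈ cl η.toFinset u ∧ c ∉ cl η.toFinset u}
    · rw [ind_of_mem hm, ind_of_mem hy, ind_of_mem (show ω ∈ {η : BondConfig V | b ∈ cl η.toFinset a ∧ c ∉ cl η.toFinset a} from ⟨jb.2 ⟨hm, hy.1⟩, fun hc => hy.2 (jc.1 hc).2⟩)]
      unfold rcWeightW
      linear_combination (weight (fun e => (w e : ℝ)) ω) * hpow
    · rw [ind_of_mem hm, ind_of_not_mem hy, ind_of_not_mem (show ω ∉ {η : BondConfig V | b ∈ cl η.toFinset a ∧ c ∉ cl η.toFinset a} from fun hU => hy ⟨(jb.1 hU.1).2, fun hc => hU.2 (jc.2 ⟨hm, hc⟩)⟩)]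
      ring
  · rw [ind_of_not_mem hm, ind_of_not_mem (show ω ∉ {η : BondConfig V | b ∈ cl η.toFinset a ∧ c ∉ cl η.toFinset a} from fun hU => hm (jb.1 hU.1).1)]
    ring

/-- **Pointwise, cell `U_c`.** [this work] -/
theorem pt_Uc (ω : BondConfig V) :
    rcWeightW w q ∅ ω * ind {η : BondConfig V | b ∉ cl η.toFinset a ∧ c ∈ cl η.toFinset a} ω * q ^ clusterCount (∅ : BondConfig V) ({u, u} : Set V) =
      weight (fun e => (w e : ℝ)) ω * ((ind {η : BondConfig V | u ∈ cl η.toFinset a} (ω ∩ ↑DX) * q ^ clusterCount (ω ∩ ↑DX) ({u, u} : Set V)) * (ind {η : BondConfig V | b ∉ cl η.toFinset u ∧ c ∈ cl η.toFinset u} (ω \ ↑DX) * q ^ clusterCount (ω \ ↑DX) ({u, u} : Set V))) := by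
  by_cases hω : ω ⊆ ↑DX ∪ ↑DY
  swap
  · obtain ⟨e, heω, heD⟩ := Set.not_subset.1 hω
    have h0 := ApexTwoSum.weight_eq_zero_of_mem_not_mem w hw heω heD
    unfold rcWeightW
    rw [h0]; ring
  have jb := glued_t_iff hau hsepD haY hab hbX hω
  have jc := glued_t_iff hau hsepD haY hac hcX hω
  have hadd := ApexTwoSum.kT_add hsepD hω
  have hk : clusterCount ω ∅ = clusterCount ω ({u, u} : Set V) := (clusterCount_pair_self u ω).symm
  have hpow : q ^ clusterCount ω ∅ * q ^ clusterCount (∅ : BondConfig V) ({u, u} : Set V) = q ^ clusterCount (ω ∩ ↑DX) ({u, u} : Set V) * q ^ clusterCount (ω \ ↑DX) ({u, u} : Set V) := by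
    rw [← pow_add, hk, hadd, pow_add]
  by_cases hm : (ω ∩ ↑DX) ∈ {η : BondConfig V | u ∈ cl η.toFinset a}
  · by_cases hy : (ω \ ↑DX) ∈ {η : BondConfig V | b ∉ cl η.toFinset u ∧ c ∈ cl η.toFinset u}
    · rw [ind_of_mem hm, ind_of_mem hy, ind_of_mem (show ω ∈ {η : BondConfig V | b ∉ cl η.toFinset a ∧ c ∈ cl η.toFinset a} from ⟨fun hb => hy.1 (jb.1 hb).2, jc.2 ⟨hm, hy.2⟩⟩)]
      unfold rcWeightW
      linear_combination (weight (fun e => (w e : ℝ)) ω) * hpow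
    · rw [ind_of_mem hm, ind_of_not_mem hy, ind_of_not_mem (show ω ∉ {η : BondConfig V | b ∉ cl η.toFinset a ∧ c ∈ cl η.toFinset a} from fun hU => hy ⟨fun hb => hU.1 (jb.2 ⟨hm, hb⟩), (jc.1 hU.2).2⟩)]
      ring
  · rw [ind_of_not_mem hm, ind_of_not_mem (show ω ∉ {η : BondConfig V | b ∉ cl η.toFinset a ∧ c ∈ cl η.toFinset a} from fun hU => hm (jc.1 hU.2).1)]
    ring

include hcu hbc in
/-- **Pointwise, separating cell `S`** (under `c ∈ cl DY b`). [this work] -/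
theorem pt_S (HY : c ∈ cl DY b) (ω : BondConfig V) :
    rcWeightW w q ∅ ω * ind {η : BondConfig V | b ∉ cl η.toFinset a ∧ c ∉ cl η.toFinset a ∧ Sep (DX ∪ DY) (cl η.toFinset a) b c} ω * q ^ clusterCount (∅ : BondConfig V) ({u, u} : Set V) =
      weight (fun e => (w e : ℝ)) ω * ((ind {η : BondConfig V | u ∈ cl η.toFinset a} (ω ∩ ↑DX) * q ^ clusterCount (ω ∩ ↑DX) ({u, u} : Set V)) * (ind {η : BondConfig V | b ∉ cl η.toFinset u ∧ c ∉ cl η.toFinset u ∧ Sep DY (cl η.toFinset u) b c} (ω \ ↑DX) * q ^ clusterCount (ω \ ↑DX) ({u, u} : Set V))) := by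
  by_cases hω : ω ⊆ ↑DX ∪ ↑DY
  swap
  · obtain ⟨e, heω, heD⟩ := Set.not_subset.1 hω
    have h0 := ApexTwoSum.weight_eq_zero_of_mem_not_mem w hw heω heD
    unfold rcWeightW
    rw [h0]; ring
  have jb := glued_t_iff hau hsepD haY hab hbX hω
  have jc := glued_t_iff hau hsepD haY hac hcX hω
  have hadd := ApexTwoSum.kT_add hsepD hω
  have hk : clusterCount ω ∅ = clusterCount ω ({u, u} : Set V) := (clusterCount_pair_self u ω).symm
  have hpow : q ^ clusterCount ω ∅ * q ^ clusterCount (∅ : BondConfig V) ({u, u} : Set V) = q ^ clusterCount (ω ∩ ↑DX) ({u, u} : Set V) * q ^ clusterCount (ω \ ↑DX) ({u, u} : Set V) := by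
    rw [← pow_add, hk, hadd, pow_add]
  by_cases hm : (ω ∩ ↑DX) ∈ {η : BondConfig V | u ∈ cl η.toFinset a}
  · by_cases hy : (ω \ ↑DX) ∈ {η : BondConfig V | b ∉ cl η.toFinset u ∧ c ∉ cl η.toFinset u ∧ Sep DY (cl η.toFinset u) b c}
    · rw [ind_of_mem hm, ind_of_mem hy, ind_of_mem (show ω ∈ {η : BondConfig V | b ∉ cl η.toFinset a ∧ c ∉ cl η.toFinset a ∧ Sep (DX ∪ DY) (cl η.toFinset a) b c} from by
        have hb' : b ∉ cl ω.toFinset a := fun hb => hy.1 (jb.1 hb).2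
        have hc' : c ∉ cl ω.toFinset a := fun hc => hy.2.1 (jc.1 hc).2
        exact ⟨hb', hc', (sep_iff_of_mem hcu hbc hsepD hcX hω hm hb' hc').2 hy.2.2⟩)]
      unfold rcWeightW
      linear_combination (weight (fun e => (w e : ℝ)) ω) * hpow
    · rw [ind_of_mem hm, ind_of_not_mem hy, ind_of_not_mem (show ω ∉ {η : BondConfig V | b ∉ cl η.toFinset a ∧ c ∉ cl η.toFinset a ∧ Sep (DX ∪ DY) (cl η.toFinset a) b c} from fun hS => hy ⟨fun hb => hS.1 (jb.2 ⟨hm, hb⟩), fun hc => hS.2.1 (jc.2 ⟨hm, hc⟩), (sep_iff_of_mem hcu hbc hsepD hcX hω hm hS.1 hS.2.1).1 hS.2.2⟩)]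
      ring
  · rw [ind_of_not_mem hm, ind_of_not_mem (show ω ∉ {η : BondConfig V | b ∉ cl η.toFinset a ∧ c ∉ cl η.toFinset a ∧ Sep (DX ∪ DY) (cl η.toFinset a) b c} from fun hS => not_sep_of_not_mem hau hsepD haY hω hm HY hS.2.2)]
    ring

end Pointwise

section Main

variable {DX DY D : Finset (Sym2 V)} {a b c u : V} (hau : a ≠ u) (hbu : b ≠ u) (hcu : c ≠ u) (hab : a ≠ b) (hac : a ≠ c) (hbc : b ≠ c)
  (hsepD : ∀ x : V, (∃ e ∈ DX, x ∈ e) → (∃ e ∈ DY, x ∈ e) → (x = u ∨ x = u))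
  (haY : ∀ e ∈ DY, a ∉ e) (hbX : ∀ e ∈ DX, b ∉ e) (hcX : ∀ e ∈ DX, c ∉ e) (hD : ∀ e, e ∈ D ↔ e ∈ DX ∨ e ∈ DY)
  (w wX wY : Sym2 V → unitInterval) {q : ℝ} (hq : 0 < q)
  (hw : ∀ e, e ∉ (↑DX ∪ ↑DY : Set (Sym2 V)) → (w e : ℝ) = 0)
  (hX : ∀ e ∈ (↑DX : Set (Sym2 V)), wX e = w e) (hX' : ∀ e ∉ (↑DX : Set (Sym2 V)), wX e = 0)
  (hY : ∀ e ∈ (↑DX : Set (Sym2 V)), wY e = 0) (hY' : ∀ e ∉ (↑DX : Set (Sym2 V)), wY e = w e)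
include hau hab hac hsepD haY hbX hcX hw hX hX' hY hY'

/-- **Dictionary, cell `T`**: `K·Zφ(T) = M_X · R_Y(T)`. [this work] -/
theorem glued_T_sum :
    (∑ ω : BondConfig V, rcWeightW w q ∅ ω * ind {η : BondConfig V | b ∈ cl η.toFinset a ∧ c ∈ cl η.toFinset a} ω) * q ^ clusterCount (∅ : BondConfig V) ({u, u} : Set V) = (∑ η : BondConfig V, rcWeightW wX q ({u, u} : Set V) η * ind {η : BondConfig V | u ∈ cl η.toFinset a} η) * (∑ η : BondConfig V, rcWeightW wY q ({u, u} : Set V) η * ind {η : BondConfig V | b ∈ cl η.toFinset u ∧ c ∈ cl η.toFinset u} η) := by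
  rw [Finset.sum_mul, Finset.sum_congr rfl fun ω _ => pt_T hau hab hac hsepD haY hbX hcX w q hw ω]
  have e1 := ApexTwoSum.sum_weight_blocks_rc w wX wY (↑DX) hX hX' hY hY' q ({u, u} : Set V) (fun x => ind {η : BondConfig V | u ∈ cl η.toFinset a} x) (fun y => ind {η : BondConfig V | b ∈ cl η.toFinset u ∧ c ∈ cl η.toFinset u} y)
  beta_reduce at e1
  rw [← e1]

/-- **Dictionary, cell `U_b`.** [this work] -/
theorem glued_Ub_sum :
    (∑ ω : BondConfig V, rcWeightW w q ∅ ω * ind {η : BondConfig V | b ∈ cl η.toFinset a ∧ c ∉ cl η.toFinset a} ω) * q ^ clusterCount (∅ : BondConfig V) ({u, u} : Set V) = (∑ η : BondConfig V, rcWeightW wX q ({u, u} : Set V) η * ind {η : BondConfig V | u ∈ cl η.toFinset a} η) * (∑ η : BondConfig V, rcWeightW wY q ({u, u} : Set V) η * ind {η : BondConfig V | b ∈ cl η.toFinset u ∧ c ∉ cl η.toFinset u} η) := by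
  rw [Finset.sum_mul, Finset.sum_congr rfl fun ω _ => pt_Ub hau hab hac hsepD haY hbX hcX w q hw ω]
  have e1 := ApexTwoSum.sum_weight_blocks_rc w wX wY (↑DX) hX hX' hY hY' q ({u, u} : Set V) (fun x => ind {η : BondConfig V | u ∈ cl η.toFinset a} x) (fun y => ind {η : BondConfig V | b ∈ cl η.toFinset u ∧ c ∉ cl η.toFinset u} y)
  beta_reduce at e1
  rw [← e1]

/-- **Dictionary, cell `U_c`.** [this work] -/
theorem glued_Uc_sum :
    (∑ ω : BondConfig V, rcWeightW w q ∅ ω * ind {η : BondConfig V | b ∉ cl η.toFinset a ∧ c ∈ cl η.toFinset a} ω) * q ^ clusterCount (∅ : BondConfig V) ({u, u} : Set V) = (∑ η : BondConfig V, rcWeightW wX q ({u, u} : Set V) η * ind {η : BondConfig V | u ∈ cl η.toFinset a} η) * (∑ η : BondConfig V, rcWeightW wY q ({u, u} : Set V) η * ind {η : BondConfig V | b ∉ cl η.toFinset u ∧ c ∈ cl η.toFinset u} η) := by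
  rw [Finset.sum_mul, Finset.sum_congr rfl fun ω _ => pt_Uc hau hab hac hsepD haY hbX hcX w q hw ω]
  have e1 := ApexTwoSum.sum_weight_blocks_rc w wX wY (↑DX) hX hX' hY hY' q ({u, u} : Set V) (fun x => ind {η : BondConfig V | u ∈ cl η.toFinset a} x) (fun y => ind {η : BondConfig V | b ∉ cl η.toFinset u ∧ c ∈ cl η.toFinset u} y)
  beta_reduce at e1
  rw [← e1]

include hcu hbc in
/-- **Dictionary, separating cell.** [this work] -/
theorem glued_S_sum (HY : c ∈ cl DY b) :
    (∑ ω : BondConfig V, rcWeightW w q ∅ ω * ind {η : BondConfig V | b ∉ cl η.toFinset a ∧ c ∉ cl η.toFinset a ∧ Sep (DX ∪ DY) (cl η.toFinset a) b c} ω) * q ^ clusterCount (∅ : BondConfig V) ({u, u} : Set V) = (∑ η : BondConfig V, rcWeightW wX q ({u, u} : Set V) η * ind {η : BondConfig V | u ∈ cl η.toFinset a} η) * (∑ η : BondConfig V, rcWeightW wY q ({u, u} : Set V) η * ind {η : BondConfig V | b ∉ cl η.toFinset u ∧ c ∉ cl η.toFinset u ∧ Sep DY (cl η.toFinset u) b c}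 η) := by
  rw [Finset.sum_mul, Finset.sum_congr rfl fun ω _ => pt_S hau hcu hab hac hbc hsepD haY hbX hcX w q hw HY ω]
  have e1 := ApexTwoSum.sum_weight_blocks_rc w wX wY (↑DX) hX hX' hY hY' q ({u, u} : Set V) (fun x => ind {η : BondConfig V | u ∈ cl η.toFinset a} x) (fun y => ind {η : BondConfig V | b ∉ cl η.toFinset u ∧ c ∉ cl η.toFinset u ∧ Sep DY (cl η.toFinset u) b c} y)
  beta_reduce at e1
  rw [← e1]

include hcu hbc hD hq in
/-- **The apex-block 1-sum theorem for R1, measure level** (every `q > 0`; see the module docstring). [this work] -/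
theorem r1_of_apexBlock (HY : c ∈ cl DY b)
    (hR1Y : (rcMeasureW wY q ∅).real {η : BondConfig V | b ∈ cl η.toFinset u ∧ c ∈ cl η.toFinset u} * (rcMeasureW wY q ∅).real {η : BondConfig V | b ∉ cl η.toFinset u ∧ c ∉ cl η.toFinset u ∧ Sep DY (cl η.toFinset u) b c} ≤ (rcMeasureW wY q ∅).real {η : BondConfig V | b ∈ cl η.toFinset u ∧ c ∉ cl η.toFinset u} * (rcMeasureW wY q ∅).real {η : BondConfig V | b ∉ cl η.toFinset u ∧ c ∈ cl η.toFinset u}) :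
    (rcMeasureW w q ∅).real {η : BondConfig V | b ∈ cl η.toFinset a ∧ c ∈ cl η.toFinset a} * (rcMeasureW w q ∅).real {η : BondConfig V | b ∉ cl η.toFinset a ∧ c ∉ cl η.toFinset a ∧ Sep D (cl η.toFinset a) b c} ≤ (rcMeasureW w q ∅).real {η : BondConfig V | b ∈ cl η.toFinset a ∧ c ∉ cl η.toFinset a} * (rcMeasureW w q ∅).real {η : BondConfig V | b ∉ cl η.toFinset a ∧ c ∈ cl η.toFinset a} := by
  have hDD : D = DX ∪ DY := by ext e; rw [Finset.mem_union]; exact hD e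
  subst hDD
  have hZ := rcPartitionFunctionW_pos w hq (∅ : Set V)
  have hZY := rcPartitionFunctionW_pos wY hq (∅ : Set V)
  have hK : 0 < q ^ clusterCount (∅ : BondConfig V) ({u, u} : Set V) := pow_pos hq _
  have hnn : ∀ (u' : Sym2 V → unitInterval) (E : Set (BondConfig V)),
      0 ≤ ∑ η : BondConfig V, rcWeightW u' q ({u, u} : Set V) η * ind E η := fun u' E =>
    Finset.sum_nonneg fun η _ => mul_nonneg (rcWeightW_nonneg u' hq.le _ η) (ind_nonneg E η)
  -- the far piece's cells: free masses = `{u,u}`-wired masses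
  have hfree : ∀ (E : Set (BondConfig V)), ∑ η : BondConfig V, rcWeightW wY q ∅ η * ind E η =
      ∑ η : BondConfig V, rcWeightW wY q ({u, u} : Set V) η * ind E η := fun E =>
    Finset.sum_congr rfl fun η _ => by unfold rcWeightW; rw [clusterCount_pair_self]
  simp only [rcMeasureW_real_eq_sum_div w hq, rcMeasureW_real_eq_sum_div wY hq] at hR1Y ⊢
  rw [hfree, hfree, hfree, hfree] at hR1Y
  rw [div_mul_div_comm, div_mul_div_comm]
  refine div_le_div_of_nonneg_right ?_ (mul_pos hZ hZ).le
  refine le_of_mul_le_mul_right (a := q ^ clusterCount (∅ : BondConfig V) ({u, u} : Set V) * q ^ clusterCount (∅ : BondConfig V) ({u, u} : Set V)) ?_ (mul_pos hK hK)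
  have eT := glued_T_sum (q := q) hau hab hac hsepD haY hbX hcX w wX wY hw hX hX' hY hY'
  have eS := glued_S_sum (q := q) hau hcu hab hac hbc hsepD haY hbX hcX w wX wY hw hX hX' hY hY' HY
  have eUb := glued_Ub_sum (q := q) hau hab hac hsepD haY hbX hcX w wX wY hw hX hX' hY hY'
  have eUc := glued_Uc_sum (q := q) hau hab hac hsepD haY hbX hcX w wX wY hw hX hX' hY hY'
  rw [show ∀ x y K : ℝ, x * y * (K * K) = (x * K) * (y * K) from fun x y K => by ring, eT, eS,
    show ∀ x y K : ℝ, x * y * (K * K) = (x * K) * (y * K) from fun x y K => by ring, eUb, eUc]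
  set M := (∑ η : BondConfig V, rcWeightW wX q ({u, u} : Set V) η * ind {η : BondConfig V | u ∈ cl η.toFinset a} η) with hM
  set Yt := (∑ η : BondConfig V, rcWeightW wY q ({u, u} : Set V) η * ind {η : BondConfig V | b ∈ cl η.toFinset u ∧ c ∈ cl η.toFinset u} η) with hYt
  set Ys := (∑ η : BondConfig V, rcWeightW wY q ({u, u} : Set V) η * ind {η : BondConfig V | b ∉ cl η.toFinset u ∧ c ∉ cl η.toFinset u ∧ Sep DY (cl η.toFinset u) b c} η) with hYs
  set Yb := (∑ η : BondConfig V, rcWeightW wY q ({u, u} : Set V) η * ind {η : BondConfig V | b ∈ cl η.toFinset u ∧ c ∉ cl η.toFinset u} η) with hYb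
  set Yc := (∑ η : BondConfig V, rcWeightW wY q ({u, u} : Set V) η * ind {η : BondConfig V | b ∉ cl η.toFinset u ∧ c ∈ cl η.toFinset u} η) with hYc
  have hZY2 : 0 < rcPartitionFunctionW wY q ∅ * rcPartitionFunctionW wY q ∅ := mul_pos hZY hZY
  have ρ : Yt * Ys ≤ Yb * Yc := by
    rw [div_mul_div_comm, div_mul_div_comm, div_le_div_iff_of_pos_right hZY2] at hR1Y
    exact hR1Y
  have hM0 : 0 ≤ M := hnn _ _
  calc M * Yt * (M * Ys) = (M * M) * (Yt * Ys) := by ring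
    _ ≤ (M * M) * (Yb * Yc) := mul_le_mul_of_nonneg_left ρ (mul_nonneg hM0 hM0)
    _ = M * Yb * (M * Yc) := by ring

end Main

end OneSumApex

end Summit.CriticalPhenomena.PercolationContinuityZ3.Theorems
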